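import Literature.AlgebraicGeometry.Resolution.BlowupAlgebraDerivations
import Literature.AlgebraicGeometry.Resolution.BlowupChartRegular
import HarnessLib

/-!
# The affine blowup algebra `R[I/xᵢ]` by evaluation at the fractions: presentation, the
exceptional prime, regularity, and derivations preserving the centre

Topic: `Literature/AlgebraicGeometry/Resolution`. Infrastructure for the chart computation of
de Jong 1996, 4.27 (the blow-up of `Spec k⟦u, v, t⟧/(uv - ∏ tᵢ)` in `(u, v, t_a, t_b)`,
`DeJong1996NodalBlowupSingularLocus` of `AlterationsNormalFormBlowupFormal.lean`), in the IMAGE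
MODEL `R[I/g] ⊆ R[1/g]` of the affine blowup algebra (`blowupAlgebra I g`,
`AffineBlowupAlgebra.lean`), `I = (x₁, …, x_r)`, `g = xᵢ`. Everything here is PROVED, mostly by
transport from the chart ring `(R[It])_{(xᵢ t)}` of the `Proj` model (`BlowupChartQuasiRegular.lean`,
`BlowupChartRegular.lean`) along `reesChartEquiv`:

* `blowupAlgebra.frac x i j = x_j/xᵢ ∈ R[I/xᵢ]` (an `abbrev` for `blowupAlgebra.gen` of
  `BlowupAlgebraDerivations.lean` at the `j`-th member of the family) and the evaluation map
  `blowupAlgebra.eval x i : R[T_j : j ≠ i] → R[I/xᵢ]`, `T_j ↦ x_j/xᵢ` (`MvPolynomial.aeval`);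
  `blowupAlgebra.toBlowupAlgebra x i` — the chart isomorphism `reesChartEquiv` as a plain ring
  homomorphism (the isomorphism is typed with the bespoke `Mul`/`Add` of
  `HomogeneousLocalization`, which makes generic lemmas about it expensive to instantiate;
  everything is transported through this ring map and its bijectivity instead);
  `toBlowupAlgebra_comp_eval₂Hom` (`eval` is the chart ring's `T_j ↦ (x_j t)/(xᵢ t)` followed by
  it), hence `eval_surjective` (GW p. 415 / Stacks 052P) and, for `x` quasi-regular,
  `eval_mem_span_algebraMap_iff'` / `comap_eval_span_algebraMap_eq` — the relations modulo `xᵢ`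
  are `I · R[T]` (Stacks 0BIQ, `ker_quotient_comp_eval₂Hom_eq` of `BlowupChartQuasiRegular.lean`);
* `blowupAlgebra.quotientSpanEquiv` — `R[I/xᵢ]/(xᵢ) ≅ (R/I)[T_j : j ≠ i]`, whence
  `isPrime_span_algebraMap` (**the exceptional ideal `(xᵢ)` is prime** when `R/I` is a domain) and
  the test by coefficients `eval_mem_span_algebraMap_iff` (`h(x_j/xᵢ) ∈ (xᵢ)` iff all
  coefficients of `h` lie in `I`);
* `blowupAlgebra.isRegularRing` — `R[I/xᵢ]` is a regular ring for `R` regular, `x` quasi-regular,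
  `R/I` regular (`isRegularRing_blowupChart`, Liu Thm. 8.1.19 (a) on the charts);
* `blowupAlgebra.comp_val_comp_eval` — **test maps**: a ring map `θ : R[1/xᵢ] → E` restricted to
  `R[I/xᵢ]` is computed on `R[T]` by evaluation, `θ ∘ eval = eval₂ (θ|_R) (θ(x_j/xᵢ))`; so
  `ker eval ≤ ker (that evaluation)` (`ker_eval_le_ker`), and ideals `M ⊇ ker eval` of `R[T]`
  descend: `comap_map_eval`, `blowupAlgebra.quotientMapEvalEquiv` (`R[I/xᵢ]/M R[I/xᵢ] ≅ R[T]/M`);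
* derivations (the extensions themselves — `exists_derivation_blowupAlgebra` of `xᵢ · δ`,
  `exists_derivation_blowupAlgebra_of_apply_eq_zero` for `δ(xᵢ) = 0`, `δ(I) ⊆ I`, and
  `Derivation.blowupAlgebra_apply_gen` — live in `AffineBlowupAlgebra.lean` /
  `BlowupAlgebraDerivations.lean`): `derivation_frac_eq_zero_of_apply_eq_zero`,
  `apply_mem_span_of_forall_apply_eq_zero`; the transport lemma
  `apply_mem_span_singleton_apply_iff` (`f z ∈ (f a) ↔ z ∈ (a)` for a bijective ring map).

## Sources

* The Stacks Project, Tags 052P, 052Q, 0BIQ (affine blowup algebras). [StacksProject]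
* U. Görtz, T. Wedhorn, *Algebraic Geometry I*, 2nd ed. (2020), (13.19) p. 415. [GortzWedhorn2020]
* Q. Liu, *Algebraic Geometry and Arithmetic Curves* (2002), Thm. 8.1.19 (a). [Liu2002]
-/

noncomputable section

open Polynomial HomogeneousLocalization IsLocalization

namespace Literature.AlgebraicGeometry.Resolution

universe u v

namespace blowupAlgebra

variable {R : Type u} [CommRing R] {r : ℕ} (x : Fin r → R) (i : Fin r)

/-- Membership of a generator in `I = (x₁, …, x_r)`. [folklore] -/
theorem mem_span_range (j : Fin r) : x j ∈ Ideal.span (Set.range x) :=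
  Ideal.subset_span (Set.mem_range_self j)

/-- The fraction `x_j/xᵢ ∈ R[I/xᵢ]`, `I = (x₁, …, x_r)`: the generator `blowupAlgebra.gen` of
`BlowupAlgebraDerivations.lean` at the `j`-th member of the family. [cite: GortzWedhorn2020, (13.19) p. 415] -/
abbrev frac (j : Fin r) : blowupAlgebra (Ideal.span (Set.range x)) (x i) :=
  blowupAlgebra.gen (Ideal.span (Set.range x)) (x i) (x j) (mem_span_range x j)

/-- The fraction as an element of `R[1/xᵢ]` (`blowupAlgebra.coe_gen`). [folklore] -/
theorem coe_frac (j : Fin r) :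
    (frac x i j : Localization.Away (x i)) =
      algebraMap R (Localization.Away (x i)) (x j) * IsLocalization.Away.invSelf (x i) :=
  blowupAlgebra.coe_gen _ _ _ _

/-- **The evaluation map `R[T_j : j ≠ i] → R[I/xᵢ]`, `T_j ↦ x_j/xᵢ`.**
[cite: GortzWedhorn2020, (13.19) p. 415] -/
def eval : MvPolynomial {j : Fin r // j ≠ i} R →ₐ[R] blowupAlgebra (Ideal.span (Set.range x)) (x i) :=
  MvPolynomial.aeval fun j => frac x i j.1

/-- `eval` on a variable. [folklore] -/
@[simp]
theorem eval_X (j : {j : Fin r // j ≠ i}) : eval x i (MvPolynomial.X j) = frac x i j.1 :=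
  MvPolynomial.aeval_X _ j

/-- `eval` on a constant. [folklore] -/
@[simp]
theorem eval_C (c : R) :
    eval x i (MvPolynomial.C c) = algebraMap R (blowupAlgebra (Ideal.span (Set.range x)) (x i)) c :=
  MvPolynomial.algHom_C _ c

/-! ## The bridge `(R[It])_{(xᵢ t)} → R[I/xᵢ]` as a plain ring homomorphism

The isomorphism `reesChartEquiv` is typed with the bespoke `Mul`/`Add` instances of
`HomogeneousLocalization`; to keep unification light we use it only through the ring
homomorphism `toBlowupAlgebra` (canonical instances) and its bijectivity. -/

/-- The chart isomorphism `(R[It])_{(xᵢ t)} ≅ R[I/xᵢ]` as a ring homomorphism.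
[cite: StacksProject, Tag 0804] -/
def toBlowupAlgebra :
    HomogeneousLocalization.Away (reesGrading (Ideal.span (Set.range x)))
        (reesT (x i) (mem_span_range x i)) →+*
      blowupAlgebra (Ideal.span (Set.range x)) (x i) :=
  (reesChartEquiv (x i) (mem_span_range x i)).toRingHom

/-- `toBlowupAlgebra` is bijective. [folklore] -/
theorem toBlowupAlgebra_bijective : Function.Bijective (toBlowupAlgebra x i) :=
  (reesChartEquiv (x i) (mem_span_range x i)).bijective

/-- `toBlowupAlgebra (φ c) = c`. [folklore] -/
theorem toBlowupAlgebra_reesChartBase (c : R) :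
    toBlowupAlgebra x i (reesChartBase (x i) (mem_span_range x i) c) =
      algebraMap R (blowupAlgebra (Ideal.span (Set.range x)) (x i)) c :=
  reesChartEquiv_reesChartBase (x i) (mem_span_range x i) c

/-- `toBlowupAlgebra ((x_j t)/(xᵢ t)) = x_j/xᵢ`. [folklore] -/
theorem toBlowupAlgebra_chartGen (j : Fin r) :
    toBlowupAlgebra x i (HomogeneousLocalization.Away.mk (reesGrading (Ideal.span (Set.range x)))
        (reesT_mem (x i) (mem_span_range x i)) 1 (reesT (x j) (mem_span_range x j))
        (reesT_mem_one_smul x j)) = frac x i j := by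
  apply Subtype.ext
  change reesChart (x i) (mem_span_range x i) _ = _
  rw [coe_frac, reesChart_mk (x i) (mem_span_range x i) _ (coe_reesT (x j) (mem_span_range x j)),
    pow_one]

/-- **`eval` is the chart ring's evaluation `T_j ↦ (x_j t)/(xᵢ t)` followed by
`(R[It])_{(xᵢ t)} ≅ R[I/xᵢ]`.** [cite: StacksProject, Tag 0804] -/
theorem toBlowupAlgebra_comp_eval₂Hom :
    (toBlowupAlgebra x i).comp
        (MvPolynomial.eval₂Hom (reesChartBase (x i) (mem_span_range x i))
          (fun j : {j : Fin r // j ≠ i} =>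
            HomogeneousLocalization.Away.mk (reesGrading (Ideal.span (Set.range x)))
              (reesT_mem (x i) (mem_span_range x i)) 1 (reesT (x j.1) (mem_span_range x j.1))
              (reesT_mem_one_smul x j.1))) =
      (eval x i).toRingHom := by
  refine MvPolynomial.ringHom_ext (fun c => ?_) (fun j => ?_)
  · rw [RingHom.comp_apply, MvPolynomial.eval₂Hom_C, AlgHom.toRingHom_eq_coe, RingHom.coe_coe,
      eval_C, toBlowupAlgebra_reesChartBase]
  · rw [RingHom.comp_apply, MvPolynomial.eval₂Hom_X', AlgHom.toRingHom_eq_coe, RingHom.coe_coe,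
      eval_X, toBlowupAlgebra_chartGen]

/-- **`eval` is surjective**: `R[I/xᵢ]` is generated over `R` by the `x_j/xᵢ` (GW p. 415;
Stacks 052P). [cite: StacksProject, Tag 052P] -/
theorem eval_surjective : Function.Surjective (eval x i) := by
  intro z
  obtain ⟨w, rfl⟩ := (toBlowupAlgebra_bijective x i).2 z
  obtain ⟨h, rfl⟩ := eval₂Hom_chartGen_surjective x i w
  refine ⟨h, ?_⟩
  have := congrArg (fun F => F h) (toBlowupAlgebra_comp_eval₂Hom x i)
  simpa only [RingHom.comp_apply, AlgHom.toRingHom_eq_coe, RingHom.coe_coe] using this.symm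

/-- Transport of "`z ∈ (a)`" along a bijective ring map `f`: `f z ∈ (f a) ↔ z ∈ (a)`.
[folklore] -/
theorem _root_.Literature.AlgebraicGeometry.Resolution.apply_mem_span_singleton_apply_iff
    {A B : Type*} [CommRing A] [CommRing B] (f : A →+* B) (hf : Function.Bijective f) (a z : A) :
    f z ∈ Ideal.span {f a} ↔ z ∈ Ideal.span {a} := by
  rw [Ideal.mem_span_singleton, Ideal.mem_span_singleton]
  constructor
  · rintro ⟨d, hd⟩
    obtain ⟨c, rfl⟩ := hf.2 d
    rw [← map_mul] at hd
    exact ⟨c, hf.1 hd⟩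
  · rintro ⟨c, rfl⟩
    exact ⟨f c, map_mul f a c⟩

/-- **The relations modulo the exceptional divisor come from `I`** (Stacks 0BIQ for a
quasi-regular `x`): `h(x_j/xᵢ) ∈ (xᵢ)` iff `h ∈ I · R[T]`. [cite: StacksProject, Tag 0BIQ] -/
theorem eval_mem_span_algebraMap_iff' (hx : IsQuasiRegular x) (h : MvPolynomial {j : Fin r // j ≠ i} R) :
    eval x i h ∈ Ideal.span {algebraMap R (blowupAlgebra (Ideal.span (Set.range x)) (x i)) (x i)} ↔
      h ∈ Ideal.map MvPolynomial.C (Ideal.span (Set.range x)) := by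
  rw [← ker_quotient_comp_eval₂Hom_eq x i hx, RingHom.mem_ker, RingHom.comp_apply,
    Ideal.Quotient.eq_zero_iff_mem, ← toBlowupAlgebra_reesChartBase x i (x i)]
  have : eval x i h = toBlowupAlgebra x i (MvPolynomial.eval₂Hom (reesChartBase (x i) (mem_span_range x i))
      (fun j : {j : Fin r // j ≠ i} =>
        HomogeneousLocalization.Away.mk (reesGrading (Ideal.span (Set.range x)))
          (reesT_mem (x i) (mem_span_range x i)) 1 (reesT (x j.1) (mem_span_range x j.1))
          (reesT_mem_one_smul x j.1)) h) := by
    have := congrArg (fun F => F h) (toBlowupAlgebra_comp_eval₂Hom x i)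
    simpa only [RingHom.comp_apply, AlgHom.toRingHom_eq_coe, RingHom.coe_coe] using this.symm
  rw [this]
  exact apply_mem_span_singleton_apply_iff (toBlowupAlgebra x i) (toBlowupAlgebra_bijective x i) _ _

/-- The same, as an equality of kernels: the kernel of `R[T_j : j ≠ i] → R[I/xᵢ] → R[I/xᵢ]/(xᵢ)`
(as a preimage) is `I · R[T]`. [cite: StacksProject, Tag 0BIQ] -/
theorem comap_eval_span_algebraMap_eq (hx : IsQuasiRegular x) :
    (Ideal.span {algebraMap R (blowupAlgebra (Ideal.span (Set.range x)) (x i)) (x i)}).comap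
        (eval x i).toRingHom =
      Ideal.map MvPolynomial.C (Ideal.span (Set.range x)) :=
  Ideal.ext fun h => eval_mem_span_algebraMap_iff' x i hx h

/-- **`R[I/xᵢ]/(xᵢ) ≅ (R/I)[T_j : j ≠ i]`** for `x` quasi-regular (the exceptional divisor of the
chart is an affine space over the centre; Stacks 0BIQ). [cite: StacksProject, Tag 0BIQ] -/
def quotientSpanEquiv (hx : IsQuasiRegular x) :
    (blowupAlgebra (Ideal.span (Set.range x)) (x i) ⧸ Ideal.span {algebraMap R
        (blowupAlgebra (Ideal.span (Set.range x)) (x i)) (x i)}) ≃+*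
      MvPolynomial {j : Fin r // j ≠ i} (R ⧸ Ideal.span (Set.range x)) :=
  have hker : RingHom.ker ((Ideal.Quotient.mk (Ideal.span {algebraMap R
      (blowupAlgebra (Ideal.span (Set.range x)) (x i)) (x i)})).comp (eval x i).toRingHom) =
      Ideal.map MvPolynomial.C (Ideal.span (Set.range x)) := by
    rw [← RingHom.comap_ker, Ideal.mk_ker]
    exact comap_eval_span_algebraMap_eq x i hx
  (RingHom.quotientKerEquivOfSurjective (f := (Ideal.Quotient.mk (Ideal.span {algebraMap R
      (blowupAlgebra (Ideal.span (Set.range x)) (x i)) (x i)})).comp (eval x i).toRingHom)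
      (Ideal.Quotient.mk_surjective.comp (eval_surjective x i))).symm.trans
    ((Ideal.quotEquivOfEq hker).trans
      (MvPolynomial.quotientEquivQuotientMvPolynomial (Ideal.span (Set.range x))).toRingEquiv.symm)

/-- **The exceptional ideal `(xᵢ) ⊆ R[I/xᵢ]` is prime** when `R/I` is a domain and `x` is
quasi-regular. [cite: StacksProject, Tag 0BIQ] -/
theorem isPrime_span_algebraMap (hx : IsQuasiRegular x) [IsDomain (R ⧸ Ideal.span (Set.range x))] :
    (Ideal.span {algebraMap R (blowupAlgebra (Ideal.span (Set.range x)) (x i)) (x i)}).IsPrime := by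
  rw [← Ideal.Quotient.isDomain_iff_prime]
  exact MulEquiv.isDomain (MvPolynomial {j : Fin r // j ≠ i} (R ⧸ Ideal.span (Set.range x)))
    (quotientSpanEquiv x i hx).toMulEquiv

/-- **Membership in `(xᵢ)` tested by coefficients**: for `x` quasi-regular, `h(x_j/xᵢ) ∈ (xᵢ)`
iff all coefficients of `h ∈ R[T_j : j ≠ i]` lie in `I`. [cite: StacksProject, Tag 0BIQ] -/
theorem eval_mem_span_algebraMap_iff (hx : IsQuasiRegular x) (h : MvPolynomial {j : Fin r // j ≠ i} R) :
    eval x i h ∈ Ideal.span {algebraMap R (blowupAlgebra (Ideal.span (Set.range x)) (x i)) (x i)} ↔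
      ∀ m, h.coeff m ∈ Ideal.span (Set.range x) := by
  rw [eval_mem_span_algebraMap_iff' x i hx, MvPolynomial.mem_map_C_iff]

/-- **`R[I/xᵢ]` is a regular ring** when `R` is regular, `x` quasi-regular and `R/I` regular
(Liu Thm. 8.1.19 (a) on the charts, `isRegularRing_blowupChart`, transported along
`(R[It])_{(xᵢ t)} ≅ R[I/xᵢ]`). [cite: Liu2002, Thm. 8.1.19 (a)] -/
theorem isRegularRing [IsRegularRing R] (hx : IsQuasiRegular x)
    [IsRegularRing (R ⧸ Ideal.span (Set.range x))] :
    IsRegularRing (blowupAlgebra (Ideal.span (Set.range x)) (x i)) :=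
  haveI := isRegularRing_blowupChart x i hx
  IsRegularRing.of_ringEquiv
    (R := HomogeneousLocalization.Away (reesGrading (Ideal.span (Set.range x)))
      (reesT (x i) (mem_span_range x i)))
    (RingEquiv.ofBijective (toBlowupAlgebra x i) (toBlowupAlgebra_bijective x i))

/-! ## Test maps: ring maps out of `R[1/xᵢ]` restricted to `R[I/xᵢ]` -/

section Test

variable {E : Type v} [CommRing E] (θ : Localization.Away (x i) →+* E)

/-- A ring map `θ : R[1/xᵢ] → E` restricted to `R[I/xᵢ]` is computed on `R[T]` by evaluation:
`θ ∘ eval = eval₂ (θ|_R) (θ(x_j/xᵢ))`. [folklore] -/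
theorem comp_val_comp_eval :
    (θ.comp (blowupAlgebra (Ideal.span (Set.range x)) (x i)).val.toRingHom).comp (eval x i).toRingHom =
      MvPolynomial.eval₂Hom (θ.comp (algebraMap R (Localization.Away (x i))))
        (fun j : {j : Fin r // j ≠ i} => θ (frac x i j.1)) := by
  refine MvPolynomial.ringHom_ext (fun c => ?_) (fun j => ?_)
  · simp only [RingHom.comp_apply, AlgHom.toRingHom_eq_coe, RingHom.coe_coe, eval_C,
      MvPolynomial.eval₂Hom_C]
    rfl
  · simp only [RingHom.comp_apply, AlgHom.toRingHom_eq_coe, RingHom.coe_coe, eval_X,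
      MvPolynomial.eval₂Hom_X']
    rfl

/-- Hence the relations of `R[I/xᵢ]` are relations of every such evaluation:
`ker eval ≤ ker (eval₂ (θ|_R) (θ(x_j/xᵢ)))`. [folklore] -/
theorem ker_eval_le_ker :
    RingHom.ker (eval x i).toRingHom ≤
      RingHom.ker (MvPolynomial.eval₂Hom (θ.comp (algebraMap R (Localization.Away (x i))))
        (fun j : {j : Fin r // j ≠ i} => θ (frac x i j.1))) := by
  intro h hh
  rw [RingHom.mem_ker] at hh ⊢
  rw [← comp_val_comp_eval x i θ, RingHom.comp_apply, hh, map_zero]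

end Test

/-- For an ideal `M ⊇ ker eval` of `R[T]`: `eval⁻¹(eval(M)) = M`. [folklore] -/
theorem comap_map_eval {M : Ideal (MvPolynomial {j : Fin r // j ≠ i} R)}
    (hM : RingHom.ker (eval x i).toRingHom ≤ M) :
    (M.map (eval x i).toRingHom).comap (eval x i).toRingHom = M := by
  rw [Ideal.comap_map_of_surjective (eval x i).toRingHom (fun z => eval_surjective x i z),
    ← RingHom.ker_eq_comap_bot, sup_eq_left]
  exact hM

/-- For an ideal `M ⊇ ker eval` of `R[T]`: `R[I/xᵢ]/(M R[I/xᵢ]) ≅ R[T]/M`. [folklore] -/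
def quotientMapEvalEquiv {M : Ideal (MvPolynomial {j : Fin r // j ≠ i} R)}
    (hM : RingHom.ker (eval x i).toRingHom ≤ M) :
    (blowupAlgebra (Ideal.span (Set.range x)) (x i) ⧸ M.map (eval x i).toRingHom) ≃+*
      MvPolynomial {j : Fin r // j ≠ i} R ⧸ M := by
  refine (RingHom.quotientKerEquivOfSurjective (f := (Ideal.Quotient.mk (M.map (eval x i).toRingHom)).comp
    (eval x i).toRingHom) (Ideal.Quotient.mk_surjective.comp (eval_surjective x i))).symm.trans ?_
  refine Ideal.quotEquivOfEq ?_
  rw [← RingHom.comap_ker, Ideal.mk_ker]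
  exact comap_map_eval x i hM

/-- For a prime `M ⊇ ker eval`, `M R[I/xᵢ]` is prime. [folklore] -/
theorem isPrime_map_eval {M : Ideal (MvPolynomial {j : Fin r // j ≠ i} R)} [M.IsPrime]
    (hM : RingHom.ker (eval x i).toRingHom ≤ M) : (M.map (eval x i).toRingHom).IsPrime :=
  Ideal.map_isPrime_of_surjective (eval_surjective x i) hM

/-! ## Derivations of `R[I/xᵢ]` (complements to `BlowupAlgebraDerivations.lean`) -/

section Derivations

variable (k : Type v) [CommRing k] [Algebra k R]

/-- Values on the named fractions of the plain extension
`exists_derivation_blowupAlgebra_of_apply_eq_zero` (`BlowupAlgebraDerivations.lean`) of a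
derivation `δ` with `δ(xᵢ) = 0`, `δ(I) ⊆ I`: `D(x_j/xᵢ) = 0` whenever `δ(x_j) = 0`. [folklore] -/
theorem derivation_frac_eq_zero_of_apply_eq_zero
    (D : Derivation k (blowupAlgebra (Ideal.span (Set.range x)) (x i))
      (blowupAlgebra (Ideal.span (Set.range x)) (x i)))
    (δ : Derivation k R R)
    (hδI : ∀ y ∈ Ideal.span (Set.range x), δ y ∈ Ideal.span (Set.range x))
    (hD : ∀ (y : R) (hy : y ∈ Ideal.span (Set.range x)),
      D (blowupAlgebra.gen _ (x i) y hy) = blowupAlgebra.gen _ (x i) (δ y) (hδI y hy))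
    (j : Fin r) (hj : δ (x j) = 0) : D (frac x i j) = 0 := by
  rw [frac, hD (x j) (mem_span_range x j)]
  apply Subtype.ext
  rw [blowupAlgebra.coe_gen, hj, map_zero, zero_mul]
  rfl

/-- A derivation killing the generators of `I` preserves `I` (the hypothesis `δ(I) ⊆ I` of
`exists_derivation_blowupAlgebra_of_apply_eq_zero`). [folklore] -/
theorem apply_mem_span_of_forall_apply_eq_zero (δ : Derivation k R R) (h : ∀ j, δ (x j) = 0)
    {y : R} (hy : y ∈ Ideal.span (Set.range x)) : δ y ∈ Ideal.span (Set.range x) := by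
  refine Submodule.span_induction (p := fun y _ => δ y ∈ Ideal.span (Set.range x)) ?_ ?_ ?_ ?_ hy
  · rintro _ ⟨j, rfl⟩
    rw [h j]
    exact Ideal.zero_mem _
  · rw [map_zero]
    exact Ideal.zero_mem _
  · intro a b _ _ ha hb
    rw [map_add]
    exact Ideal.add_mem _ ha hb
  · intro c a ha hca
    rw [smul_eq_mul, Derivation.leibniz, smul_eq_mul, smul_eq_mul]
    exact Ideal.add_mem _ (Ideal.mul_mem_left _ _ hca) (Ideal.mul_mem_right _ _ ha)

end Derivations

end blowupAlgebra

end Literature.AlgebraicGeometry.Resolution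

end
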